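import Summits.Ventures.WeilGRH.TwistedTwoPrimeCert
import HarnessLib

/-!
# Moment-method certificates for TWISTED Weil weights, XI: soundness of the two-prime certificate `TwistCert23`

Cell `rh-explicit`, WEIL TRACK — GRH ARM (namespace `Summit.Ventures.WeilGRH`).  The soundness theorem of the
polar-free two-prime moment-method certificate `TwistCert23` (`TwistedTwoPrimeCert.lean`; proof verbatim from
`TwistedMomentCertSound.lean` over the two-prime chain layer):

**`TwistCert23.form_nonneg_of_check`.**  Let `c.checkAlg = true`, let the cells be a valid chain for SOME weight
(`CellsOKW23 c.frame.wL c.frame.T c.cells w` — supplied by the Boolean cell checker `checkCellsZS23` of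
`TwistedTwoPrimeCells.lean` via `cellsOKW23_of_checkCellsZS23`), let `W` be a weight with `wL − γ(τ) ≤ W(τ)` for all `τ` (`γ = cellsGamma₂₃ wL cells`;
e.g. `W ≥ w` with `w` even, `TwistCert23.form_nonneg_of_check_mono`) such that `|ĝ(1/2+iτ)|² W(τ)` is integrable
for the test function at hand, and let `ℓ ≥ c.ellLo`.  Then for every test function `g` with
`tsupport g ⊆ [−b, b]`:

  `0 ≤ ℓ ‖g‖₂² + (1/2π) ∫ |ĝ(1/2+iτ)|² W(τ) dτ`.

Proof = the `ζ` Stage-C proof (`WeilCert3.weilFirstPrimeQuadratic_nonneg_of_check`) with Step A (the polar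
Taylor bound) deleted and `−log π` replaced by the generic level: Step B (minorant, here
`TwistCert23.arch_lower_bound`), Step C (`TwistCert23.freq_integral_bound`), the signed-`γ` price of the rational
`1/(2π)`, the rounding of the matrix and of the shifted table (`TwistCert23.abs_pmQ_sub_pmQexact_le`: the shift
cancels the hard-wired polar matrix, `TwistCert23.pmQexact_cast`), `κ`, Bessel (`weilNorm2Sq_ge_bessel`) and the
algebraic core `WeilCert.core_nonnegK` — verbatim.  Everything here is PROVED; no named facts; nothing about
zeros of any `L`-function.  The Dirichlet-character instances (`W = M_{χ,2} − (log q − log π)`) are in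
`TwistedMomentDirichlet.lean`.

## References

* H. Yoshida, *On Hermitian forms attached to zeta functions*, Adv. Stud. Pure Math. 21 (1992), §2 (2.1), §6,
  Theorem 1 (p. 310).
-/

noncomputable section

open Complex Finset MeasureTheory Set Filter
open scoped Real Topology ComplexConjugate BigOperators

namespace Summit.Ventures.WeilGRH

open Literature.NumberTheory.LFunctions
open Literature.Analysis.ValidatedNumerics.Numerics
open Literature.Analysis.SpecialFunctions

namespace TwistCert23

variable {c : TwistCert23} {w W : ℝ → ℝ} {g : ℝ → ℂ}

/-! ### Step B: the minorant -/

/-- **Minorant bound.** `wL · 2π ‖g‖₂² − ∫ ‖ĝ‖² γ ≤ ∫ ‖ĝ(1/2+it)‖² W(t) dt` for any weight `W` with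
`wL − γ ≤ W` pointwise and `|ĝ|² W` integrable. [folklore] -/
theorem arch_lower_bound (hlevel : ∀ t : ℝ, (c.frame.wL : ℝ) - cellsGamma₂₃ c.frame.wL c.cells t ≤ W t)
    (hg : IsWeilTest g) (hWi : Integrable fun t : ℝ ↦ ‖weilMellin g (1 / 2 + t * I)‖ ^ 2 * W t) :
    (c.frame.wL : ℝ) * (2 * π * weilNorm2Sq g) -
        ∫ t : ℝ, ‖weilMellin g (1 / 2 + t * I)‖ ^ 2 * cellsGamma₂₃ c.frame.wL c.cells t ≤
      ∫ t : ℝ, ‖weilMellin g (1 / 2 + t * I)‖ ^ 2 * W t := by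
  obtain ⟨B, hB0, hB⟩ := exists_abs_cellsGamma₂₃_le c.frame.wL c.cells
  set σ : ℝ → ℝ := fun t ↦ (c.frame.wL : ℝ) - cellsGamma₂₃ c.frame.wL c.cells t with hσ
  have hσm : Measurable σ := measurable_const.sub (measurable_cellsGamma₂₃ _ _)
  have hσb : ∀ t, |σ t| ≤ (|(c.frame.wL : ℝ)| + B) + 0 * t ^ 2 := fun t ↦ by
    rw [hσ, zero_mul, add_zero]
    exact (abs_sub _ _).trans (add_le_add le_rfl (hB t))
  have hi1 : Integrable fun t : ℝ ↦ ‖weilMellin g (1 / 2 + t * I)‖ ^ 2 * σ t :=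
    integrable_norm_sq_weilMellin_mul hg hσm (by positivity) le_rfl hσb
  have h := integral_mono hi1 hWi fun t ↦ mul_le_mul_of_nonneg_left (hlevel t) (sq_nonneg _)
  refine le_trans (le_of_eq ?_) h
  have hj1 := integrable_norm_sq_weilMellin_half_line hg
  have hj2 : Integrable fun t : ℝ ↦ ‖weilMellin g (1 / 2 + t * I)‖ ^ 2 * cellsGamma₂₃ c.frame.wL c.cells t :=
    integrable_norm_sq_weilMellin_mul hg (measurable_cellsGamma₂₃ _ _) hB0 le_rfl (B := 0)
      (fun t ↦ by simpa using hB t)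
  have e : (fun t : ℝ ↦ ‖weilMellin g (1 / 2 + t * I)‖ ^ 2 * σ t) = fun t : ℝ ↦
      (c.frame.wL : ℝ) * ‖weilMellin g (1 / 2 + t * I)‖ ^ 2 -
        ‖weilMellin g (1 / 2 + t * I)‖ ^ 2 * cellsGamma₂₃ c.frame.wL c.cells t := by
    funext t; rw [hσ]; ring
  rw [e, integral_sub (hj1.const_mul _) hj2, integral_const_mul,
    integral_norm_sq_weilMellin_half_line hg]

/-! ### The main theorem -/

set_option maxHeartbeats 1600000 in
/-- **Soundness of the polar-free moment-method certificate.** If `c.checkAlg = true`, the cells are a valid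
chain for some weight `w` (structural facts), `wL − γ ≤ W` pointwise with `|ĝ|² W` integrable, and
`ellLo ≤ ℓ`, then for every test function `g` with `tsupport g ⊆ [-b, b]`:
`0 ≤ ℓ ‖g‖₂² + (1/2π) ∫ |ĝ(1/2+iτ)|² W(τ) dτ`. [folklore] -/
theorem form_nonneg_of_check (h : c.checkAlg = true) (hcells : CellsOKW23 c.frame.wL c.frame.T c.cells w)
    (hlevel : ∀ t : ℝ, (c.frame.wL : ℝ) - cellsGamma₂₃ c.frame.wL c.cells t ≤ W t)
    {ℓ : ℝ} (hℓ : ((c.ellLo : ℚ) : ℝ) ≤ ℓ) (hg : IsWeilTest g)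
    (hWi : Integrable fun t : ℝ ↦ ‖weilMellin g (1 / 2 + t * I)‖ ^ 2 * W t)
    (hsupp : tsupport g ⊆ Icc (-(c.b : ℝ)) c.b) :
    0 ≤ ℓ * weilNorm2Sq g + 1 / (2 * π) * ∫ t : ℝ, ‖weilMellin g (1 / 2 + t * I)‖ ^ 2 * W t := by
  obtain ⟨hsc, hnuchk, hb0, hb1⟩ := checkAlg_spec h
  obtain ⟨⟨hbpos, hba, ha1q⟩, ⟨hT, haT, hρT⟩, hN, hκ⟩ := twistScalars_spec hsc
  set a : ℝ := (c.frame.a0 : ℝ) with ha_def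
  have hba' : ((c.b : ℚ) : ℝ) ≤ a := by rw [ha_def]; exact_mod_cast hba
  have hb0' : (0 : ℝ) < c.b := by exact_mod_cast hbpos
  have ha : 0 < a := by linarith
  have hsupp' : tsupport g ⊆ Icc (-a) a := hsupp.trans (Icc_subset_Icc (by linarith) hba')
  set n := c.frame.N + 1 with hn
  set nu := c.nuTab with hnu
  set M : ℕ → ℂ := weilMoment a g with hM
  set L := weilNorm1 g with hL
  set N2 := weilNorm2Sq g with hN2
  set z : ℕ → ℕ → ℝ := fun k l ↦ (conj (M k) * M l).re with hz
  have hL0 : 0 ≤ L := weilNorm1_nonneg g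
  have hN20 : 0 ≤ N2 := weilNorm2Sq_nonneg g
  have hL1 : L ^ 2 ≤ 2 * a * N2 := weilNorm1_sq_le hg ha hsupp'
  set A : ℝ := ∫ t : ℝ, ‖weilMellin g (1 / 2 + t * I)‖ ^ 2 * W t with hA
  set Γ : ℝ := ∫ t : ℝ, ‖weilMellin g (1 / 2 + t * I)‖ ^ 2 * cellsGamma₂₃ c.frame.wL c.cells t with hΓ
  -- Step B
  have hB : (c.frame.wL : ℝ) * (2 * π * N2) - Γ ≤ A := arch_lower_bound hlevel hg hWi
  -- Step C
  have hC : Γ ≤ ∑ k ∈ range n, ∑ l ∈ range n, gHat c k l * z k l + 5 * L ^ 2 * (c.nuPrimeAbs : ℝ) := by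
    have := freq_integral_bound hcells hsc hg (by rwa [← ha_def])
    rw [← ha_def] at this
    exact this
  -- constants
  set q : ℝ := ((invTwoPiHi20 : ℚ) : ℝ) with hq
  set qLo : ℝ := ((invTwoPiLo20 : ℚ) : ℝ) with hqLo
  have hq1 : 1 / (2 * π) ≤ q := invTwoPiHi20_ge
  have hq0 : 0 ≤ q := invTwoPiHi20_nonneg
  have hqLo1 : qLo ≤ 1 / (2 * π) := invTwoPiLo20_le
  have hν0 : 0 ≤ ((c.nuPrimeAbs : ℚ) : ℝ) := by
    unfold nuPrimeAbs
    have h1 : (0 : ℝ) ≤ (cellsAbsMomentQ₂₃ c.frame.wL c.cells (c.frame.N + 1) : ℝ) := by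
      rw [← (integral_stepAux₂₃_mul_powW (wL := c.frame.wL) hcells.valid (c.frame.N + 1)).2]
      refine integral_nonneg fun s' ↦ mul_nonneg ((stepAux₂₃_propsW (wL := c.frame.wL)
        hcells.valid).1.choose_spec s').1 ?_
      have hev : Even (c.frame.N + 1) := ⟨c.frame.nb, by omega⟩
      rw [← hev.pow_abs]; positivity
    push_cast
    have ha0 : (0 : ℝ) ≤ (c.frame.a0 : ℝ) := by rw [← ha_def]; exact ha.le
    positivity
  have hpi : 0 < 1 / (2 * π) := by positivity
  -- the signed `Γ`: `−(1/2π)Γ ≥ −qX − (q − qLo)·C₀·7·N2`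
  set C₀ : ℝ := ((cellsBndMaxQ₂₃ c.frame.wL c.cells : ℚ) : ℝ) with hC₀
  have hC₀0 : 0 ≤ C₀ := by rw [hC₀]; exact_mod_cast cellsBndMaxQ₂₃_nonneg c.frame.wL c.cells
  have hγabs : ∀ t, |cellsGamma₂₃ c.frame.wL c.cells t| ≤ C₀ := fun t ↦ by
    rw [hC₀]; exact abs_cellsGamma₂₃_le_bndMaxW hcells t
  set ind : ℝ → ℝ := Set.indicator (Icc (-(c.frame.T : ℝ)) c.frame.T) (fun _ ↦ (1 : ℝ)) with hind
  have hind01 : ∀ t, 0 ≤ ind t ∧ ind t ≤ 1 := fun t ↦ by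
    rw [hind]; by_cases ht : t ∈ Icc (-(c.frame.T : ℝ)) c.frame.T
    · rw [Set.indicator_of_mem ht]; norm_num
    · rw [Set.indicator_of_notMem ht]; norm_num
  have hindm : Measurable ind := by rw [hind]; exact measurable_const.indicator measurableSet_Icc
  set PiT : ℝ := ∫ t : ℝ, ‖weilMellin g (1 / 2 + t * I)‖ ^ 2 * ind t with hPiT
  have hiPiT : Integrable fun t : ℝ ↦ ‖weilMellin g (1 / 2 + t * I)‖ ^ 2 * ind t :=
    integrable_norm_sq_weilMellin_mul hg hindm (A := 1) (B := 0) zero_le_one le_rfl fun t ↦ by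
      rw [zero_mul, add_zero, abs_of_nonneg (hind01 t).1]; exact (hind01 t).2
  obtain ⟨BΓ, hBΓ0, hBΓ⟩ := exists_abs_cellsGamma₂₃_le c.frame.wL c.cells
  have hiΓ : Integrable fun t : ℝ ↦ ‖weilMellin g (1 / 2 + t * I)‖ ^ 2 * cellsGamma₂₃ c.frame.wL c.cells t :=
    integrable_norm_sq_weilMellin_mul hg (measurable_cellsGamma₂₃ _ _) hBΓ0 le_rfl (B := 0)
      (fun t ↦ by simpa using hBΓ t)
  have hPiT0 : 0 ≤ PiT := integral_nonneg fun t ↦ mul_nonneg (sq_nonneg _) (hind01 t).1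
  have hPiTle : PiT ≤ 7 * N2 := by
    have h1 : PiT ≤ ∫ t : ℝ, ‖weilMellin g (1 / 2 + t * I)‖ ^ 2 :=
      integral_mono hiPiT (integrable_norm_sq_weilMellin_half_line hg) fun t ↦ by
        simpa using mul_le_mul_of_nonneg_left (hind01 t).2 (sq_nonneg ‖weilMellin g (1 / 2 + t * I)‖)
    rw [integral_norm_sq_weilMellin_half_line hg] at h1
    have h7 : 2 * π ≤ 7 := by linarith [Real.pi_lt_d2]
    nlinarith
  have hΓplus : 0 ≤ Γ + C₀ * PiT := by
    rw [hΓ, hPiT, ← integral_const_mul, ← integral_add hiΓ (hiPiT.const_mul _)]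
    refine integral_nonneg fun t ↦ ?_
    rw [show ‖weilMellin g (1 / 2 + t * I)‖ ^ 2 * cellsGamma₂₃ c.frame.wL c.cells t +
        C₀ * (‖weilMellin g (1 / 2 + t * I)‖ ^ 2 * ind t) =
        ‖weilMellin g (1 / 2 + t * I)‖ ^ 2 * (cellsGamma₂₃ c.frame.wL c.cells t + C₀ * ind t) by ring]
    refine mul_nonneg (sq_nonneg _) ?_
    by_cases ht : t ∈ Icc (-(c.frame.T : ℝ)) c.frame.T
    · have : ind t = 1 := by rw [hind, Set.indicator_of_mem ht]
      rw [this, mul_one]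
      linarith [neg_abs_le (cellsGamma₂₃ c.frame.wL c.cells t), hγabs t]
    · have : ind t = 0 := by rw [hind, Set.indicator_of_notMem ht]
      have hT' : (c.frame.T : ℝ) ≤ |t| := by
        rw [Set.mem_Icc, not_and_or, not_le, not_le] at ht
        rcases ht with ht | ht
        · linarith [neg_abs_le t, le_abs_self t, neg_le_abs t]
        · exact ht.le.trans (le_abs_self t)
      rw [this, mul_zero, add_zero, cellsGamma₂₃_eq_zeroW hcells hT']
  have hΓlow : -(q * (∑ k ∈ range n, ∑ l ∈ range n, gHat c k l * z k l + 5 * L ^ 2 * (c.nuPrimeAbs : ℝ))) -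
      (q - qLo) * C₀ * (7 * N2) ≤ -(1 / (2 * π) * Γ) := by
    have e : -(1 / (2 * π) * Γ) = -(1 / (2 * π)) * (Γ + C₀ * PiT) + 1 / (2 * π) * (C₀ * PiT) := by ring
    rw [e]
    have h1 : -q * (Γ + C₀ * PiT) ≤ -(1 / (2 * π)) * (Γ + C₀ * PiT) := by nlinarith
    have h2 : qLo * (C₀ * PiT) ≤ 1 / (2 * π) * (C₀ * PiT) :=
      mul_le_mul_of_nonneg_right hqLo1 (mul_nonneg hC₀0 hPiT0)
    have h3 : q * Γ ≤ q * (∑ k ∈ range n, ∑ l ∈ range n, gHat c k l * z k l + 5 * L ^ 2 * (c.nuPrimeAbs : ℝ)) :=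
      mul_le_mul_of_nonneg_left hC hq0
    have hqq : 0 ≤ q - qLo := by linarith [invTwoPiLo20_le_invTwoPiHi20]
    have h4 : (q - qLo) * C₀ * PiT ≤ (q - qLo) * C₀ * (7 * N2) :=
      mul_le_mul_of_nonneg_left hPiTle (mul_nonneg hqq hC₀0)
    nlinarith
  -- combine B, C (no Step A: the form has no polar term)
  have hB' : (c.frame.wL : ℝ) * N2 - 1 / (2 * π) * Γ ≤ 1 / (2 * π) * A := by
    calc (c.frame.wL : ℝ) * N2 - 1 / (2 * π) * Γ = 1 / (2 * π) * ((c.frame.wL : ℝ) * (2 * π * N2) - Γ) := by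
          field_simp
      _ ≤ 1 / (2 * π) * A := mul_le_mul_of_nonneg_left hB hpi.le
  have h5 : ((c.ellLo : ℚ) : ℝ) * N2 ≤ ℓ * N2 := mul_le_mul_of_nonneg_right hℓ hN20
  have step1 : ∑ k ∈ range n, ∑ l ∈ range n, (-(q * gHat c k l)) * z k l +
      ((c.frame.wL : ℝ) + (c.ellLo : ℚ) - 7 * (q - qLo) * C₀) * N2 -
      (5 * q * (c.nuPrimeAbs : ℝ)) * L ^ 2 ≤ ℓ * N2 + 1 / (2 * π) * A := by
    have e1 : ∑ k ∈ range n, ∑ l ∈ range n, (-(q * gHat c k l)) * z k l =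
        -(q * ∑ k ∈ range n, ∑ l ∈ range n, gHat c k l * z k l) := by
      rw [Finset.mul_sum, ← Finset.sum_neg_distrib]
      refine Finset.sum_congr rfl fun k _ ↦ ?_
      rw [Finset.mul_sum, ← Finset.sum_neg_distrib]
      refine Finset.sum_congr rfl fun l _ ↦ ?_
      ring
    rw [e1]
    linarith [hB', hΓlow, h5]
  -- rounding of the matrix and of the (shifted) moment table, together: `|prQ − Pexact| ≤ δ`
  have hMk : ∀ k, ‖M k‖ ≤ L := fun k ↦ norm_weilMoment_le hg ha hsupp' k
  set q6 : ℝ := ((invTwoPiHi : ℚ) : ℝ) with hq6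
  have hq60 : 0 ≤ q6 := invTwoPiHi_nonneg
  set δ : ℝ := 1 / 2 ^ c.frame.pg + q6 * (1 / 2 ^ c.pnu) with hδ
  have hδ0 : 0 ≤ δ := by rw [hδ]; positivity
  have hround : ∑ k ∈ range n, ∑ l ∈ range n, ((c.frame.prQ nu k l : ℚ) : ℝ) * z k l -
      ∑ k ∈ range n, ∑ l ∈ range n, (-(q * gHat c k l)) * z k l ≤ δ * (n : ℝ) ^ 2 * L ^ 2 := by
    refine WeilCert3.quad_rounding_le' n (fun k l ↦ ((c.frame.prQ nu k l : ℚ) : ℝ)) _ δ L hδ0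
      (fun k hk l hl ↦ ?_) M hMk
    have h1 : |((c.frame.prQ nu k l : ℚ) : ℝ) - ((c.frame.pmQ nu k l : ℚ) : ℝ)| ≤ 1 / 2 ^ c.frame.pg := by
      rw [abs_sub_comm]
      unfold WeilCert.prQ
      exact abs_cast_sub_ratRd_le c.frame.pg (c.frame.pmQ nu k l)
    have h2q := abs_pmQ_sub_pmQexact_le hnuchk (by omega : k < c.frame.N + 1) (by omega : l < c.frame.N + 1)
    have h2 : |((c.frame.pmQ nu k l : ℚ) : ℝ) - ((pmQexact c k l : ℚ) : ℝ)| ≤ q6 * (1 / 2 ^ c.pnu) := by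
      have h := (Rat.cast_le (K := ℝ)).2 h2q
      rw [hnu, hq6]
      push_cast at h ⊢
      exact h
    have h3 : ((pmQexact c k l : ℚ) : ℝ) = -(q * gHat c k l) := by rw [pmQexact_cast, hq]
    rw [hδ, ← h3]
    exact (abs_sub_le _ _ _).trans (add_le_add h1 h2)
  -- κ_exact
  have hcoef : 0 ≤ 5 * q * (c.nuPrimeAbs : ℝ) + δ * (n : ℝ) ^ 2 :=
    add_nonneg (mul_nonneg (mul_nonneg (by norm_num) hq0) hν0) (by positivity)
  have hkex : ((c.kappaExact : ℚ) : ℝ) =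
      ((c.frame.wL : ℝ) + (c.ellLo : ℚ) - 7 * (q - qLo) * C₀) -
        2 * a * (5 * q * (c.nuPrimeAbs : ℝ) + δ * (n : ℝ) ^ 2) := by
    rw [hq, hqLo, hC₀, hn, ha_def, hδ, hq6]
    unfold kappaExact
    push_cast
    ring
  have hκle : ((c.kappaQ : ℚ) : ℝ) ≤ ((c.kappaExact : ℚ) : ℝ) := by
    unfold kappaQ; exact_mod_cast ratRd_le c.frame.pg _
  have hκ0 : (0 : ℝ) ≤ ((c.kappaQ : ℚ) : ℝ) := by exact_mod_cast hκ
  -- E ≥ Σ pr z + κ N2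
  have step3 : ∑ k ∈ range n, ∑ l ∈ range n, ((c.frame.prQ nu k l : ℚ) : ℝ) * z k l +
      ((c.kappaQ : ℚ) : ℝ) * N2 ≤ ℓ * N2 + 1 / (2 * π) * A := by
    have h1 : ((c.kappaQ : ℚ) : ℝ) * N2 ≤ ((c.kappaExact : ℚ) : ℝ) * N2 :=
      mul_le_mul_of_nonneg_right hκle hN20
    rw [hkex] at h1
    have h2 := mul_le_mul_of_nonneg_left hL1 hcoef
    linarith [step1, hround, h1, h2]
  -- Bessel and the algebraic core
  have hbes : 2 * (∑ k ∈ range n, conj (c.frame.uVec M k) * M k).re -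
      (∑ k ∈ range n, ∑ l ∈ range n, conj (c.frame.uVec M k) * c.frame.uVec M l * (gramH a k l : ℂ)).re ≤ N2 :=
    weilNorm2Sq_ge_bessel hg ha hsupp' n (c.frame.uVec M)
  have hcore : 0 ≤ (∑ k ∈ range n, ∑ l ∈ range n, ((c.frame.prQ nu k l : ℚ) : ℝ) * z k l) +
      ((c.kappaQ : ℚ) : ℝ) *
        (2 * (∑ k ∈ range n, conj (c.frame.uVec M k) * M k).re -
          (∑ k ∈ range n, ∑ l ∈ range n,
            conj (c.frame.uVec M k) * c.frame.uVec M l * (gramH a k l : ℂ)).re) := by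
    have := WeilCert.core_nonnegK (c := c.frame) (nu := nu) (κ := c.kappaQ) hN hb0 hb1 a ha_def.symm M
    rw [← hn] at this
    exact this
  have h4 := mul_le_mul_of_nonneg_left hbes hκ0
  linarith [step3, h4, hcore]

/-- **Soundness, monotone form.** As `form_nonneg_of_check`, with the cells valid for an EVEN weight `w` and
the target weight `W ≥ w` pointwise. [folklore] -/
theorem form_nonneg_of_check_mono (h : c.checkAlg = true) (hcells : CellsOKW23 c.frame.wL c.frame.T c.cells w)
    (heven : ∀ t, w (-t) = w t) (hwW : ∀ t, w t ≤ W t)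
    {ℓ : ℝ} (hℓ : ((c.ellLo : ℚ) : ℝ) ≤ ℓ) (hg : IsWeilTest g)
    (hWi : Integrable fun t : ℝ ↦ ‖weilMellin g (1 / 2 + t * I)‖ ^ 2 * W t)
    (hsupp : tsupport g ⊆ Icc (-(c.b : ℝ)) c.b) :
    0 ≤ ℓ * weilNorm2Sq g + 1 / (2 * π) * ∫ t : ℝ, ‖weilMellin g (1 / 2 + t * I)‖ ^ 2 * W t :=
  form_nonneg_of_check h hcells (fun t ↦ (level_sub_cellsGamma₂₃_leW hcells heven t).trans (hwW t))
    hℓ hg hWi hsupp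

end TwistCert23

end Summit.Ventures.WeilGRH

end
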